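/-
Copyright (c) 2026 the pub-hodgecm-mathlib formalisation cell (harness21).  Prover seat hodgecm-mathlib-F0P3a-p03 (g25): N8-INNER road, brick (10)(C′)
«CORNER EP PACKAGE», FILE F-C′ (the value of the corner class function: the letter's limit read on the glued extension).
-/
import Literature.NumberTheory.Rogawski1990.ArchCornerOnePlaceReading              -- ★ F-B (this seat): the one-place reading kit at `β₀`
import Literature.NumberTheory.Rogawski1990.ArchCentralLimitFunctionalAlternation  -- ★ p852167 (this seat): `twelve_mul_eq_six_mul_of_alternation_eq_vandermonde_smul`
import Literature.NumberTheory.Rogawski1990.ArchCentralLimitLettersHold            -- ★ the letter `ArchCentralLimitFormulaRankTwo_holds`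
import Literature.NumberTheory.Rogawski1990.ArchCentralLimitChamberExtension       -- ★ `tendsto_lambda8_rhoWeylDelta_nhdsWithin_of_contDiff`, `continuous_iteratedDeriv_three_line_of_contDiff`
import HarnessLib

/-!
# The value of the corner class function: `12·h₁(0) = 6ℓ`, `ℓ = −c′·i·fa(ζ•1)` (N8-INNER brick (10)(C′), FILE F-C′)

Topic `NumberTheory/Rogawski1990`; namespace `Literature.NumberTheory.Rogawski1990`.  THEOREMS ONLY (no `def`, no instance, no notation, no axiom, no named
fact, no `sorry`); kernel lane `--supports stmt-HodgeConjecture-24833`.  Cell `pub/hodgecm-mathlib`, crux H413; road N8-INNER (owner LH2-plan (g1)), brick (10)(C′)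
«CORNER EP PACKAGE» (F0P3a-p03 (g25)).  Count-neutral.  Companion of ★ `ArchCornerOnePlaceGlue` (§1 glue `F̃`, §2 alternation `Σ_σ sign(σ)H(·∘σ) = Vand•h₁`,
§3 slot sum `u·Σ_σ R(·∘σ) = h₁`): here the VALUE `h₁(0)`.

THE ARGUMENT.  The letter ★ `ArchCentralLimitFormulaRankTwo_holds` (Harish-Chandra's limit formula at the centre of `U(2,1)`, phase pinned) says
`Λ_z[F_fa](z) → ℓ := −c′i·fa(diag(ζ,ζ,ζ))` as `z → (ζ,ζ,ζ)` through REGULAR torus points, `c′ > 0`.  Pull back along the angle chart `x ↦ ζe^{ix}` within the regular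
angles `C` (★ `injective_angleChart_of_injective`); near `0` on `C` the letter's `F_fa∘chart` IS the normalised reading `N·R` (★ F-B `chartOrbGLoc_quasiSplitWeights_eq_orbital`,
`ρ′Δ(ζe^{ix}) = N(x)`), hence equals the global smooth cut-off `H` of the glue; so ★ `tendsto_lambda8_rhoWeylDelta_nhdsWithin_of_contDiff` computes the same limit as
`(ωH)(0) = Λ[H](0)`, and uniqueness of limits gives `Λ[H](0) = ℓ`.  Finally `12·h₁(0) = 6·Λ[H](0)` is ★ `twelve_mul_eq_six_mul_of_alternation_eq_vandermonde_smul`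
(`Λ[H]` is continuous for smooth `H`).

## References
* [Rogawski1990] J. D. Rogawski, *Automorphic Representations of Unitary Groups in Three Variables*, Ann. of Math. Stud. 123 (1990), §8.4 pp. 126–127.
* [HarishChandra1975HARRG1] Harish-Chandra, *Harmonic analysis on real reductive groups I*, J. Funct. Anal. 19 (1975), §17 Lemma 17.5.
-/

set_option autoImplicit false

noncomputable section

open MeasureTheory MeasureTheory.Measure NumberField NumberField.InfinitePlace Matrix Complex Set Filter Topology Function Metric
open scoped MatrixGroups Matrix Real Classical ENNReal NNReal ContDiff
open Literature.NumberTheory.Automorphic Literature.NumberTheory.Automorphic.UnitaryGroup Literature.NumberTheory.Automorphic.ArchCartan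
open Literature.NumberTheory.Automorphic.Shelstad1979.StableOrbitalIntegrals
open Literature.Geometry.ComplexHyperbolic.BallModel Literature.Analysis.Calculus

namespace Literature.NumberTheory.Rogawski1990

/-! ## The value at the corner: `12·h₁(0) = 6ℓ`, `ℓ = −c′·i·fa(ζ•1)` -/

section Value

variable (L : Type) [Field L] [NumberField L] [IsCMField L] (w : {w : InfinitePlace L // IsComplex w})
  [MeasurableSpace ↥(archLocal L 3 (Matrix.diagonal ![(2 : L)⁻¹, 1, -(2 : L)⁻¹]) w)] [BorelSpace ↥(archLocal L 3 (Matrix.diagonal ![(2 : L)⁻¹, 1, -(2 : L)⁻¹]) w)]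
  (νw : Measure ↥(archLocal L 3 (Matrix.diagonal ![(2 : L)⁻¹, 1, -(2 : L)⁻¹]) w)) [νw.IsHaarMeasure] [νw.IsMulRightInvariant]

open scoped Matrix.Norms.Operator

/-- The letter functional `Λ[H](x) = (1∕48)Σ_ε s₀s₁s₂ (d∕ds)³|₀ H(x + s·V_ε)` of a `C³` function is continuous. [cite: Rogawski1990, §8.4 p. 126]
[cite: HarishChandra1975HARRG1, §17 Lemma 17.5] -/
theorem continuous_letterFunctional_of_contDiff {H : (Fin 3 → ℝ) → ℂ} (hH : ContDiff ℝ 3 H) :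
    Continuous fun x : Fin 3 → ℝ => (1 / 48 : ℂ) * ∑ ε : Fin 3 → Bool, ((((if ε 0 then (1 : ℝ) else -1) * (if ε 1 then (1 : ℝ) else -1) * (if ε 2 then (1 : ℝ) else -1) : ℝ)) : ℂ) *
      iteratedDeriv 3 (fun s : ℝ => H (x + s • ![(if ε 0 then (1 : ℝ) else -1) + (if ε 1 then (1 : ℝ) else -1), -(if ε 0 then (1 : ℝ) else -1) + (if ε 2 then (1 : ℝ) else -1), -(if ε 1 then (1 : ℝ) else -1) - (if ε 2 then (1 : ℝ) else -1)])) 0 := by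
  refine continuous_const.mul (continuous_finsetSum _ fun ε _ => continuous_const.mul ?_)
  refine (continuous_iteratedDeriv_three_line_of_contDiff hH ![(if ε 0 then (1 : ℝ) else -1) + (if ε 1 then (1 : ℝ) else -1), -(if ε 0 then (1 : ℝ) else -1) + (if ε 2 then (1 : ℝ) else -1), -(if ε 1 then (1 : ℝ) else -1) - (if ε 2 then (1 : ℝ) else -1)]).congr fun x => ?_
  congr 1
  funext s
  rw [add_comm]

/-- **THE VALUE AT THE CORNER: `12·h₁(0) = 6ℓ` WITH `ℓ = −c′i·fa(diag(ζ,ζ,ζ))`, `c′ > 0` THE LETTER'S CONSTANT.**  Data: `F̃ = N·R` off the walls on `ball 0 r`, `H = F̃` on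
`ball 0 (r∕4)` globally smooth, `Σ_σ sign(σ)H(·∘σ) = Vand•h₁` on `ball 0 (r∕2)`.  The letter ★ `ArchCentralLimitFormulaRankTwo_holds` gives `Λ_z[F_fa] → ℓ` along the regular torus
points at `(ζ,ζ,ζ)`; pulled back along the angle chart `x ↦ ζe^{ix}` (★ `injective_angleChart_of_injective`) this is the limit of `Λ_z[F_fa]∘chart` within the regular angles; on
those, near `0`, `F_fa∘chart = N·R = H` (★ F-B `chartOrbGLoc_quasiSplitWeights_eq_orbital`), so ★ `tendsto_lambda8_rhoWeylDelta_nhdsWithin_of_contDiff` identifies the same limit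
as `(ωH)(0) = Λ[H](0)`; and `12·h₁(0) = 6·Λ[H](0)` is ★ `twelve_mul_eq_six_mul_of_alternation_eq_vandermonde_smul`. [cite: Rogawski1990, §8.4 pp. 126–127]
[cite: HarishChandra1975HARRG1, §17 Lemma 17.5] -/
theorem exists_letterConstant_twelve_mul_eq (ζ : Circle) {θζ : ℝ} (hζ : Circle.exp θζ = ζ)
    (f : ↥(archLocal L 3 (Matrix.diagonal ![(2 : L)⁻¹, 1, -(2 : L)⁻¹]) w) → ℂ) (fa : Matrix (Fin 3) (Fin 3) ℂ → ℂ) (hfa : ContDiff ℝ ∞ fa)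
    (hf : ∀ g, f g = fa ((g : GL (Fin 3) ℂ) : Matrix (Fin 3) (Fin 3) ℂ)) (hfs : HasCompactSupport f)
    {r : ℝ} (hr : 0 < r) (Ft H h₁ : (Fin 3 → ℝ) → ℂ)
    (hFtR : ∀ x ∈ ball (0 : Fin 3 → ℝ) r, x 0 ≠ x 2 → x 1 ≠ x 2 →
      Ft x = ((Circle.exp (x 0 - x 2) : Circle) : ℂ) *
        ((1 - ((Circle.exp (x 1 - x 0) : Circle) : ℂ)) * (1 - ((Circle.exp (x 2 - x 0) : Circle) : ℂ)) * (1 - ((Circle.exp (x 2 - x 1) : Circle) : ℂ))) *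
          chartOrbGLoc L ![(2 : L)⁻¹, 1, -(2 : L)⁻¹] w (∅ : Finset {w : InfinitePlace L // IsComplex w}) νw f ((fun _ : Fin 3 => θζ) + x))
    (hH : ContDiff ℝ ∞ H) (hh₁ : ContDiff ℝ ∞ h₁) (hHFt : ∀ x ∈ ball (0 : Fin 3 → ℝ) (r / 4), H x = Ft x)
    (hA : ∀ x ∈ ball (0 : Fin 3 → ℝ) (r / 2), (∑ σ : Equiv.Perm (Fin 3), ((Equiv.Perm.sign σ : ℤ) : ℂ) * H (x ∘ ⇑σ)) =
      ((x 0 - x 1) * (x 0 - x 2) * (x 1 - x 2)) • h₁ x) :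
    ∃ c : ℝ, 0 < c ∧ (12 : ℂ) * h₁ 0 = 6 * (-((c : ℂ) * Complex.I) * fa ((circleDiagonal 3 (fun _ : Fin 3 => ζ) : GL (Fin 3) ℂ) : Matrix (Fin 3) (Fin 3) ℂ)) := by
  -- frame data and the one-place instances the letter asks for
  have hα := quasiSplitWeights_ne_zero L
  have hreal := im_embedding_quasiSplitWeights_eq_zero L w
  have hind : ∃ i j : Fin 3, (w.1.embedding ((![(2 : L)⁻¹, 1, -(2 : L)⁻¹]) i)).re * (w.1.embedding ((![(2 : L)⁻¹, 1, -(2 : L)⁻¹]) j)).re < 0 :=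
    ⟨0, 2, re_embedding_quasiSplitWeights_zero_mul_two_neg L w⟩
  haveI := locallyCompactSpace_archLocal_three L ![(2 : L)⁻¹, 1, -(2 : L)⁻¹] w
  haveI := secondCountableTopology_archLocal_three L ![(2 : L)⁻¹, 1, -(2 : L)⁻¹] w
  have hw0 : w ∉ (∅ : Finset {w : InfinitePlace L // IsComplex w}) := Finset.notMem_empty w
  have hfs' : HasCompactSupport fun k : ↥(archLocal L 3 (Matrix.diagonal ![(2 : L)⁻¹, 1, -(2 : L)⁻¹]) w) => fa ((k : GL (Fin 3) ℂ) : Matrix (Fin 3) (Fin 3) ℂ) := by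
    have : (fun k : ↥(archLocal L 3 (Matrix.diagonal ![(2 : L)⁻¹, 1, -(2 : L)⁻¹]) w) => fa ((k : GL (Fin 3) ℂ) : Matrix (Fin 3) (Fin 3) ℂ)) = f := (funext hf).symm
    rw [this]; exact hfs
  -- (1) the letter at `β₀`, `w`, `νw`, `fa`, `ζ`
  obtain ⟨c, hc, hletter⟩ := ArchCentralLimitFormulaRankTwo_holds L ![(2 : L)⁻¹, 1, -(2 : L)⁻¹] w hα hreal hind νw
  have T1 := hletter fa hfa hfs' ζ
  -- (2) pull back along the angle chart within the regular angles `C`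
  set C : Set (Fin 3 → ℝ) := ball (0 : Fin 3 → ℝ) (1 / 2) ∩ {θ : Fin 3 → ℝ | Function.Injective θ} with hCdef
  have hC : IsOpen C := isOpen_ball.inter Literature.Topology.isOpen_setOf_injective
  have hchart : Continuous fun θ : Fin 3 → ℝ => fun k : Fin 3 => ζ * Circle.exp (θ k) :=
    continuous_pi fun k => continuous_const.mul (Circle.exp.continuous.comp (continuous_apply k))
  have T0 : Tendsto (fun θ : Fin 3 → ℝ => fun k : Fin 3 => ζ * Circle.exp (θ k)) (𝓝[C] 0) (𝓝[{z : Fin 3 → Circle | Function.Injective z}] (fun _ => ζ)) := by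
    refine tendsto_nhdsWithin_iff.2 ⟨?_, ?_⟩
    · have h := hchart.tendsto (0 : Fin 3 → ℝ)
      simp only [Pi.zero_apply, Circle.exp_zero, mul_one] at h
      exact h.mono_left nhdsWithin_le_nhds
    · filter_upwards [self_mem_nhdsWithin] with θ hθ
      refine injective_angleChart_of_injective hθ.2 fun i j => ?_
      have hb := mem_ball_zero_iff.1 hθ.1
      rw [pi_norm_lt_iff (by norm_num : (0:ℝ) < 1 / 2)] at hb
      have hi := hb i; have hj := hb j
      rw [Real.norm_eq_abs, abs_lt] at hi hj
      rw [abs_lt]; constructor <;> linarith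
  have T2 := T1.comp T0
  -- (3) the same limit read on the corner extension `H`
  set Φ : (Fin 3 → Circle) → ℂ := fun z => ∫ g, fa (((g * ⟨circleDiagonal 3 z, circleDiagonal_mem_archLocal_diagonal L 3 ![(2 : L)⁻¹, 1, -(2 : L)⁻¹] w _⟩ * g⁻¹ :
      ↥(archLocal L 3 (Matrix.diagonal ![(2 : L)⁻¹, 1, -(2 : L)⁻¹]) w)) : GL (Fin 3) ℂ) : Matrix (Fin 3) (Fin 3) ℂ) ∂νw with hΦdef
  have hCW : ∀ᶠ θ in 𝓝[C] (0 : Fin 3 → ℝ), θ ∈ C ∧ θ ∈ ball (0 : Fin 3 → ℝ) (r / 4) :=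
    eventually_mem_nhdsWithin.and (mem_nhdsWithin_of_mem_nhds (ball_mem_nhds _ (by positivity)))
  have T3 := tendsto_lambda8_rhoWeylDelta_nhdsWithin_of_contDiff Φ ζ C hC H (hH.of_le (by norm_cast)) (by
    filter_upwards [hCW] with θ hθ
    obtain ⟨⟨-, hθinj⟩, hθr⟩ := hθ
    have h02 : θ 0 ≠ θ 2 := fun e => absurd (hθinj e) (by decide)
    have h12 : θ 1 ≠ θ 2 := fun e => absurd (hθinj e) (by decide)
    rw [hHFt θ hθr, hFtR θ (ball_subset_ball (by linarith) hθr) h02 h12,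
      chartOrbGLoc_quasiSplitWeights_eq_orbital L w νw hw0 fa hfa.continuous hf hζ θ]
    simp only [hΦdef]
    rw [coe_circle_mul_exp_mul_inv ζ (θ 0) (θ 2), coe_circle_mul_exp_mul_inv ζ (θ 1) (θ 0), coe_circle_mul_exp_mul_inv ζ (θ 2) (θ 1),
      coe_circle_mul_exp_mul_inv ζ (θ 2) (θ 0)]
    simp only [Circle.coe_exp]
    push_cast
    ring)
  haveI : (𝓝[C] (0 : Fin 3 → ℝ)).NeBot := by
    refine mem_closure_iff_nhdsWithin_neBot.1 ?_
    exact (Literature.Topology.dense_setOf_injective.open_subset_closure_inter isOpen_ball) (mem_ball_self (by norm_num))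
  have hωℓ := tendsto_nhds_unique T3 T2
  -- (4) `12 h₁ 0 = 6 Λ[H](0)` and `Λ[H](0) = (ωH)(0)`
  have hΦev : ∀ᶠ x in 𝓝 (0 : Fin 3 → ℝ), (∑ σ : Equiv.Perm (Fin 3), ((Equiv.Perm.sign σ : ℤ) : ℂ) * H (x ∘ ⇑σ)) =
      ((x 0 - x 1) * (x 0 - x 2) * (x 1 - x 2)) • h₁ x :=
    Filter.eventually_of_mem (ball_mem_nhds (0 : Fin 3 → ℝ) (by positivity)) hA
  have hΛc := continuous_letterFunctional_of_contDiff (hH.of_le (by norm_cast))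
  have key := twelve_mul_eq_six_mul_of_alternation_eq_vandermonde_smul H hH h₁ hh₁ hΦev _ ((hΛc.tendsto 0).mono_left nhdsWithin_le_nhds)
  refine ⟨c, hc, ?_⟩
  rw [key, ← hωℓ]
  simp only [zero_add]

end Value

end Literature.NumberTheory.Rogawski1990

end
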